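import Literature.AlgebraicGeometry.Modules.CechBoxTensorBicomplex
import Literature.Algebra.Homology.OrderedCechLexSystem
import Literature.Algebra.Homology.OrderedCechSystemMap
import HarnessLib

/-!
# The Čech system of the PRODUCT COVER `(p⁻¹U_i ∩ q⁻¹V_j)_{(i,j) ∈ ι ×ₗ κ}` IS the lexicographic system of the box pair-system
# (The Stacks Project, Tag 0BEC: «`⋂_{(i,j) ∈ T} U_i × V_j = U_{π₁T} × V_{π₂T}`»)

Layer `Literature/AlgebraicGeometry/Modules`, namespace `Literature.AlgebraicGeometry.Modules`.  THEOREMS ONLY (no definition, no named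
fact, no instance, no notation, no `sorry`).  Cell `hodgecm-mathlib` (D-0151), F-11 ∕ J3 Künneth packet, (G3)∕(iv-4) BRIDGE piece (B-i)
(B-p06 (g15), second hand of F0P1b-p04 (g0); consumers: F0P1b-p02 (g2)'s F-J3b skeleton `stub_hinj`∕`stub_hsurj` on the product cover
`W₀`, F0P1b-p04's F-K3 `bijective_homologyMap_cross` on `Č(lexSystem P)`).

For morphisms `p : Z → X`, `q : Z → Y`, families of opens `𝓤 : ι → X.Opens`, `𝓥 : κ → Y.Opens` (linearly ordered finite index types),
an `𝒪_Z`-module `G` and `ρ : A → Γ(Z, ⊤)`, the tree has TWO systems of `A`-modules on `Finset (ι ×ₗ κ)`: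
* `OrderedCech.lexSystem (boxSectionsSystem p q 𝓤 𝓥 G ρ)` — `T ↦ Γ(G, p⁻¹U_{π₁T} ∩ q⁻¹V_{π₂T})` (★ `Modules/CechBoxTensorBicomplex`,
  ★ `Algebra/Homology/OrderedCechLexSystem`), the carrier of the cross product ∕ shuffle map ∕ Künneth formula (★
  `Algebra/Homology/OrderedCechPairSystemShuffle`), and
* `sectionsSystem W₀ G ρ` for the PRODUCT COVER `W₀ (i, j) := p⁻¹U_i ∩ q⁻¹V_j` — `T ↦ Γ(G, ⋂_{(i,j) ∈ T} (p⁻¹U_i ∩ q⁻¹V_j))`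
  (★ `Modules/ModuleCechComplex`), the carrier of the cup product and of the pull-backs `p^*`, `q^*` (F-J3b's `HS`).

* §1 **`cechOpen_prodCover_eq`** — the two opens COINCIDE: `cechOpen W₀ T = p⁻¹ cechOpen 𝓤 (π₁T) ⊓ q⁻¹ cechOpen 𝓥 (π₂T)`
  (`p⁻¹`, `q⁻¹` commute with finite intersections, ★ `preimage_cechOpen`; `Finset.inf` over an image).
* §2 **`exists_lexSystem_boxSectionsSystem_iso_sectionsSystem`** — hence an ISOMORPHISM of systems
  `lexSystem (boxSectionsSystem p q 𝓤 𝓥 G ρ) ≅ sectionsSystem W₀ G ρ`, CHARACTERISED: its components (both directions) are the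
  restriction maps `SecMod.res` along the equality of §1 (so every formula transports by `SecMod.res_res`); and
  **`exists_sysComplex_lexSystem_iso_cechComplex`** — the induced isomorphism of ordered Čech complexes
  `Č(lexSystem (boxSectionsSystem …)) ≅ Č(W₀, G)` (★ `OrderedCech.sysComplexMapIso`), componentwise the same restriction on every
  simplex (★ `OrderedCech.ext0At_sysCochainMap`).

With ★ `cechBoxBicomplexIso` ∕ `cechTensorIsoTotal` (`Č(𝓤,E) ⊗ Č(𝓥,F) ≅ Tot Č•,•`) and ★ F0P1b-p06's `nonempty_homologyIso_total_lexSystem`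
(`Hⁿ(Tot Č•,•(P)) ≅ Hⁿ(Č(lexSystem P))`) this puts the Künneth comparison on the SAME complex `Č(W₀, 𝒪_{X×Y})` on which the cup product
and `p₁^* ∪ p₂^*` live.  HC_CM is proved only modulo the 7 printed citations until rung 0 closes; pure scheme-theoretic bookkeeping.

## References
* [StacksProject] The Stacks Project, Tag 0BEC (Künneth formula: the Čech complex of the product covering), Tag 01FG.
* [GortzWedhorn2023] U. Görtz, T. Wedhorn, *Algebraic Geometry II* (2023), Def. 21.64 (p. 179), Def. 21.68 (p. 180).
-/

set_option backward.isDefEq.respectTransparency false -- `Scheme.Modules` is not reducible (as in ★ `CechBoxTensorBicomplex`)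

noncomputable section

universe u

open CategoryTheory AlgebraicGeometry TopologicalSpace
open Literature.Algebra.Homology Literature.Algebra.Homology.OrderedCech

namespace Literature.AlgebraicGeometry.Modules

variable {X Y Z : Scheme.{u}} (p : Z ⟶ X) (q : Z ⟶ Y) {A : Type u} [CommRing A]
  {ι κ : Type} [LinearOrder ι] [LinearOrder κ] (𝓤 : ι → X.Opens) (𝓥 : κ → Y.Opens) (G : Z.Modules) (ρ : A →+* Γ(Z, ⊤))

/-! ## §1 The opens of the product cover are the box opens -/

/-- **`⋂_{(i,j) ∈ T} (p⁻¹U_i ∩ q⁻¹V_j) = p⁻¹U_{π₁T} ∩ q⁻¹V_{π₂T}`**: the Čech open of the product cover `W₀ (i,j) = p⁻¹U_i ∩ q⁻¹V_j` on a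
finite `T ⊆ ι ×ₗ κ` is the box open on the two projections (Stacks 0BEC: «`U_{i₀…i_p} × V_{j₀…j_p}`»).
[cite: StacksProject, Tag 0BEC] [cite: GortzWedhorn2023, Def. 21.64 (p. 179)] -/
theorem cechOpen_prodCover_eq (T : Finset (ι ×ₗ κ)) :
    cechOpen (fun c : ι ×ₗ κ => p ⁻¹ᵁ 𝓤 (ofLex c).1 ⊓ q ⁻¹ᵁ 𝓥 (ofLex c).2) T =
      p ⁻¹ᵁ cechOpen 𝓤 (fstProj T) ⊓ q ⁻¹ᵁ cechOpen 𝓥 (sndProj T) := by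
  classical
  rw [preimage_cechOpen 𝓤 p, preimage_cechOpen 𝓥 q]
  unfold cechOpen fstProj sndProj
  rw [Finset.inf_image, Finset.inf_image, ← Finset.inf_inf]
  rfl

/-! ## §2 The isomorphism of systems and of Čech complexes -/

/-- **`lexSystem (boxSectionsSystem p q 𝓤 𝓥 G ρ) ≅ sectionsSystem W₀ G ρ`, CHARACTERISED**: there is an isomorphism of systems of
`A`-modules on `Finset (ι ×ₗ κ)` between the lexicographic system of the box pair-system and the Čech system of the product cover
`W₀ (i,j) = p⁻¹U_i ∩ q⁻¹V_j`, whose components in BOTH directions are the restriction maps `SecMod.res` along the equality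
`cechOpen_prodCover_eq` (identities of sections; naturality = transitivity of restriction). [cite: StacksProject, Tag 0BEC]
[cite: GortzWedhorn2023, Def. 21.64 (p. 179) and Def. 21.68 (p. 180)] -/
theorem exists_lexSystem_boxSectionsSystem_iso_sectionsSystem :
    ∃ e : lexSystem (boxSectionsSystem p q 𝓤 𝓥 G ρ) ≅
        sectionsSystem (fun c : ι ×ₗ κ => p ⁻¹ᵁ 𝓤 (ofLex c).1 ⊓ q ⁻¹ᵁ 𝓥 (ofLex c).2) G ρ,
      (∀ (T : Finset (ι ×ₗ κ)) (x : SecMod G ρ (p ⁻¹ᵁ cechOpen 𝓤 (fstProj T) ⊓ q ⁻¹ᵁ cechOpen 𝓥 (sndProj T))),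
        (e.hom.app T).hom x = SecMod.res G ρ (le_of_eq (cechOpen_prodCover_eq p q 𝓤 𝓥 T)) x) ∧
      (∀ (T : Finset (ι ×ₗ κ)) (y : SecMod G ρ (cechOpen (fun c : ι ×ₗ κ => p ⁻¹ᵁ 𝓤 (ofLex c).1 ⊓ q ⁻¹ᵁ 𝓥 (ofLex c).2) T)),
        (e.inv.app T).hom y = SecMod.res G ρ (le_of_eq (cechOpen_prodCover_eq p q 𝓤 𝓥 T).symm) y) := by
  refine ⟨NatIso.ofComponents (fun T => LinearEquiv.toModuleIso
    { toLinearMap := SecMod.res G ρ (le_of_eq (cechOpen_prodCover_eq p q 𝓤 𝓥 T))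
      invFun := SecMod.res G ρ (le_of_eq (cechOpen_prodCover_eq p q 𝓤 𝓥 T).symm)
      left_inv := fun x => by
        change SecMod.res G ρ _ (SecMod.res G ρ _ x) = x
        rw [SecMod.res_res, SecMod.res_self]
      right_inv := fun y => by
        change SecMod.res G ρ _ (SecMod.res G ρ _ y) = y
        rw [SecMod.res_res, SecMod.res_self] }) (fun {T T'} h => ?_), fun T x => rfl, fun T y => rfl⟩
  ext x
  change SecMod.res G ρ _ (((lexSystem (boxSectionsSystem p q 𝓤 𝓥 G ρ)).map h).hom x) =
    SecMod.res G ρ _ (SecMod.res G ρ _ x)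
  rw [lexSystem_map_apply, boxSectionsSystem_map_app_apply, boxSectionsSystem_obj_map_apply, SecMod.res_res, SecMod.res_res,
    SecMod.res_res]

/-- **`Č(lexSystem (boxSectionsSystem …)) ≅ Č(W₀, G)`**: the induced isomorphism of ordered Čech complexes (★ `OrderedCech.sysComplexMapIso`),
componentwise the restriction along `cechOpen_prodCover_eq` on every simplex (★ `OrderedCech.ext0At_sysCochainMap`).  So the Künneth comparison
of ★ `cechTensorIsoTotal` ∕ `nonempty_homologyIso_total_lexSystem` and the cup product ∕ pull-backs of the product cover live on ONE complex.
[cite: StacksProject, Tag 0BEC] [cite: GortzWedhorn2023, Def. 21.68 (p. 180)] -/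
theorem exists_sysComplex_lexSystem_iso_cechComplex :
    ∃ e : sysComplex (lexSystem (boxSectionsSystem p q 𝓤 𝓥 G ρ)) ≅
        cechComplex (fun c : ι ×ₗ κ => p ⁻¹ᵁ 𝓤 (ofLex c).1 ⊓ q ⁻¹ᵁ 𝓥 (ofLex c).2) G ρ,
      ∀ (n : ℤ) (g : SysCochain (lexSystem (boxSectionsSystem p q 𝓤 𝓥 G ρ)) n) (s t : Finset (ι ×ₗ κ)),
        SysCochain.ext0At ((e.hom.f n).hom g) s t =
          SecMod.res G ρ (le_of_eq (cechOpen_prodCover_eq p q 𝓤 𝓥 t)) (SysCochain.ext0At g s t) := by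
  obtain ⟨e, he, -⟩ := exists_lexSystem_boxSectionsSystem_iso_sectionsSystem p q 𝓤 𝓥 G ρ
  refine ⟨sysComplexMapIso e, fun n g s t => ?_⟩
  change SysCochain.ext0At (sysCochainMap e.hom n g) s t = _
  rw [ext0At_sysCochainMap, he]

end Literature.AlgebraicGeometry.Modules

end
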